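import Literature.NumberTheory.QuadraticFields.HeegnerCondition
import Mathlib.NumberTheory.NumberField.Discriminant.Different
import Mathlib.NumberTheory.RamificationInertia.Unramified
import HarnessLib

/-!
# The classical Heegner hypothesis `𝒪_K/𝔑 ≃ ℤ/Nℤ` with RAMIFIED primes allowed at exponent one (quadratic `K`)

HONEST FRAMING (cell `b2b-bsdres`, run/shared/lean/b2b/bsd-rank1-residual/, verbatim in every
file): the goal of the cell is to DELETE the COMBINATION-SHAPED residual classes of the
Birch–Swinnerton-Dyer formula for ALL analytic-rank `≤ 1` elliptic curves over `ℚ` — "full BSD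
formula for every rank `≤ 1` curve in class `C`" assembled STRICTLY from published theorems — so
that the rank-`≤ 1` remainder becomes exactly the CONSTRUCTION-SHAPED classes, which are TYPED
(missing-input `Prop`s), NOT attempted. This is not "finishing BSD". Sub-cell
`b2b-bsdres-multr1-p1` (X11b, route R1); no claim beyond the stated class; X11b stays
CONSTRUCTION-SHAPED; nothing here changes a label; no named fact (theorems only; no `sorry`).

## What this file kernel-checks, and why

The standing hypothesis of [Cas20] = F. Castella, *On the `p`-adic variation of Heegner points*,
J. Inst. Math. Jussieu 19 (2020), §2.5 (version of record, author's accepted manuscript p. 8), on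
the imaginary quadratic field `K` — under which its Thm. 2.11, the input (c) of the erratum to
[Cas18], is stated — reads VERBATIM:

> "We shall assume throughout that `K` satisfies the following Heegner hypothesis relative to a
> fixed integer `N > 0` prime to `p`:
> (heeg) there is an ideal `𝔑 ⊂ 𝒪_K` with `𝒪_K/𝔑 ≃ ℤ/Nℤ`.
> The existence of such `𝔑`, which will be fixed from now on, amounts to the requirement that
> every prime `q ∣ N` is either split or ramified in `K`, with `q² ∤ N` in the latter case."

(identically in §1, p. 2: "(heeg) there is an integral ideal `𝔑` of `K` with `𝒪_K/𝔑 ≃ ℤ/Nℤ`;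
equivalently, every prime `q ∣ N` either splits or ramifies in `K`, with `q² ∤ N` in the latter
case.") The tree proves (heeg) LITERALLY — `∃ 𝔫 : Ideal (𝓞 K), Nonempty (𝓞 K ⧸ 𝔫 ≃+* ZMod N)` —
only in the ALL-SPLIT case (`Literature.NumberTheory.QuadraticFields.SplitPrime.exists_ideal_quotient_ringEquiv_zmod`,
Gross 1991 §1). Route R1's auxiliary field (`IsErratumField`: the non-split multiplicative `q`
RAMIFIED, every other prime of `N_E` split) needs the printed equivalence with a ramified prime of
exponent one. This file proves the direction "⟸" of Castella's sentence for a quadratic field: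

* `exists_prime_of_dvd_discr` — in a quadratic field a prime `p ∣ d_K` has a prime `𝔓` of `𝓞 K`
  above it with `e(𝔓|p) = 2`, `f(𝔓|p) = 1` (Dedekind's discriminant theorem, Mathlib
  `NumberField.not_dvd_discr_iff_isUnramifiedIn`, + the fundamental identity `∑ e f = 2`);
* `nonempty_quotient_ringEquiv_zmod_of_dvd_discr` — hence `𝓞 K ⧸ 𝔓 ≃+* ℤ/pℤ`;
* `exists_ideal_quotient_ringEquiv_zmod_of_split_or_ramified` — **if every prime `q ∣ N` (`N ≥ 1`)
  either splits in `K` or is ramified (`q ∣ d_K`) with `q² ∤ N`, then there is an ideal `𝔑` of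
  `𝓞 K` with `𝓞 K ⧸ 𝔑 ≃+* ZMod N`** (`𝔑 = ∏ 𝔮_q^{v_q(N)}`, Chinese remainder theorem).

No elliptic curve occurs here; the consumer is `CastellaErratumVersionOfRecord.lean`
(`IsErratumField` ⟹ (heeg) at the tame level `N_E/p`). The converse direction of "amounts to"
is not needed by the route and is not formalised.

References: [Castella2020JIMJ] §1 (p. 2) and §2.5 (p. 8), hypothesis (heeg); B. H. Gross,
*Heegner points on `X₀(N)`* (1984) §3 [Gross1984]; D. A. Marcus, *Number Fields*, Ch. 3
(Thm. 21, the fundamental identity; Thm. 24/25, decomposition in quadratic fields).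
-/

noncomputable section

open scoped Classical

namespace Summit.BirchSwinnertonDyer.Rank1Residual.X11b.HeegnerIdeal

open Ideal NumberField Module

variable {K : Type*} [Field K] [NumberField K]

/-! ### A ramified prime of a quadratic field: `e = 2`, `f = 1` -/

/-- **In a quadratic field a prime divisor of the discriminant is ramified with residue degree
one**: if `[K : ℚ] = 2` and `p ∣ d_K` then some prime `𝔓` of `𝓞 K` above `p` has `e(𝔓|p) = 2` and
`f(𝔓|p) = 1`. Dedekind's discriminant theorem (`p ∣ d_K` iff `p` ramifies; Mathlib
`NumberField.not_dvd_discr_iff_isUnramifiedIn`) gives a prime `𝔓 ∣ p` with `e(𝔓|p) ≠ 1`; the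
fundamental identity `∑_{𝔓 ∣ p} e f = [K : ℚ] = 2` (`Ideal.sum_ramification_inertia`) then forces
`e = 2`, `f = 1`. (Marcus, *Number Fields*, Ch. 3, Thm. 24.) [folklore] -/
theorem exists_prime_of_dvd_discr (h2 : finrank ℚ K = 2) {p : ℕ} (hp : p.Prime)
    (hd : (p : ℤ) ∣ NumberField.discr K) :
    ∃ P : Ideal (𝓞 K), P.IsPrime ∧ P.LiesOver (span {(p : ℤ)}) ∧
      ramificationIdx' (span {(p : ℤ)}) P = 2 ∧ inertiaDeg' (span {(p : ℤ)}) P = 1 := by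
  have hpZ : Prime (p : ℤ) := Nat.prime_iff_prime_int.mp hp
  set q : Ideal ℤ := span {(p : ℤ)} with hq
  have hq0 : q ≠ ⊥ := by simpa [hq] using (Int.natCast_ne_zero.mpr hp.ne_zero)
  haveI hqmax : q.IsMaximal :=
    ((span_singleton_prime (Int.natCast_ne_zero.mpr hp.ne_zero)).mpr hpZ).isMaximal hq0
  -- Dedekind: `p ∣ d_K` ⟹ `p` is not unramified ⟹ some `𝔓 ∣ p` has `e(𝔓|p) ≠ 1`
  have hram : ¬ Algebra.IsUnramifiedIn (𝓞 K) q := by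
    rw [hq, ← NumberField.not_dvd_discr_iff_isUnramifiedIn K (𝓞 K) hpZ, not_not]
    exact hd
  rw [Algebra.isUnramifiedIn_iff_forall_ramificationIdx_eq_one] at hram
  push Not at hram
  obtain ⟨P, hP, hPo, hne⟩ := hram
  haveI := hP
  haveI := hPo
  have he' : ramificationIdx' q P = P.ramificationIdx ℤ :=
    Ideal.ramificationIdx'_eq_ramificationIdx q P hq0
  have hne' : ramificationIdx' q P ≠ 1 := by rw [he']; exact hne
  have he0 : ramificationIdx' q P ≠ 0 := IsDedekindDomain.ramificationIdx'_ne_zero_of_liesOver P hq0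
  have hf0 : inertiaDeg' q P ≠ 0 := inertiaDeg'_ne_zero q P
  -- the fundamental identity bounds `e f ≤ 2`
  have hsum := Ideal.sum_ramification_inertia (R := ℤ) (𝓞 K) ℚ K (p := q) hq0
  have hPf : P ∈ IsDedekindDomain.primesOverFinset q (𝓞 K) :=
    (IsDedekindDomain.mem_primesOverFinset_iff hq0 (𝓞 K)).mpr ⟨hP, hPo⟩
  have hle : ramificationIdx' q P * inertiaDeg' q P ≤ 2 := by
    rw [← h2, ← hsum]
    exact Finset.single_le_sum (f := fun Q ↦ ramificationIdx' q Q * inertiaDeg' q Q)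
      (fun _ _ ↦ Nat.zero_le _) hPf
  -- `e ≥ 2` and `e f ≤ 2` with `f ≥ 1`
  have h1 : 1 ≤ inertiaDeg' q P := Nat.pos_of_ne_zero hf0
  have h2e : 2 ≤ ramificationIdx' q P := by omega
  have hele : ramificationIdx' q P ≤ 2 := by nlinarith
  have he2 : ramificationIdx' q P = 2 := le_antisymm hele h2e
  have hf1 : inertiaDeg' q P = 1 := by
    rw [he2] at hle
    omega
  exact ⟨P, hP, hPo, he2, hf1⟩

/-- **`𝓞 K ⧸ 𝔓 ≃ ℤ/pℤ` at a ramified prime of a quadratic field**: for `[K : ℚ] = 2` and `p ∣ d_K`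
there is a prime `𝔓` of `𝓞 K` above `p` with `𝓞 K ⧸ 𝔓 ≃+* ZMod p` (residue degree one:
`#(𝓞 K ⧸ 𝔓) = p`, and a ring with `p` elements is `ℤ/pℤ`, `ZMod.ringEquivOfPrime`).
(Marcus, *Number Fields*, Ch. 3, Thm. 24.) [folklore] -/
theorem nonempty_quotient_ringEquiv_zmod_of_dvd_discr (h2 : finrank ℚ K = 2) {p : ℕ}
    (hp : p.Prime) (hd : (p : ℤ) ∣ NumberField.discr K) :
    ∃ P : Ideal (𝓞 K), P.IsPrime ∧ P.LiesOver (span {(p : ℤ)}) ∧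
      Nonempty (𝓞 K ⧸ P ≃+* ZMod p) := by
  obtain ⟨P, hP, hPo, -, hf⟩ := exists_prime_of_dvd_discr h2 hp hd
  haveI := hP
  haveI := hPo
  have hcard : Nat.card (𝓞 K ⧸ P) = p := by
    have h := Literature.NumberTheory.QuadraticFields.SplitPrime.natCard_quotient_pow hp P hf 1
    rwa [pow_one, pow_one] at h
  haveI : Finite (𝓞 K ⧸ P) := Nat.finite_of_card_ne_zero (by rw [hcard]; exact hp.ne_zero)
  letI : Fintype (𝓞 K ⧸ P) := Fintype.ofFinite (𝓞 K ⧸ P)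
  have hcard' : Fintype.card (𝓞 K ⧸ P) = p := by rw [Fintype.card_eq_nat_card, hcard]
  exact ⟨P, hP, hPo, ⟨(ZMod.ringEquivOfPrime (𝓞 K ⧸ P) hp hcard').symm⟩⟩

/-! ### (heeg) from "every `q ∣ N` split, or ramified with `q² ∤ N`" -/

/-- **The Heegner hypothesis (heeg) of [Cas20, §2.5] from its prime-by-prime form, quadratic `K`.**
If `[K : ℚ] = 2`, `N ≥ 1`, and every prime `q ∣ N` either SPLITS in `K` (two primes of `𝓞 K`
above `q`) or is RAMIFIED (`q ∣ d_K`) with `q² ∤ N`, then there is an ideal `𝔑` of `𝓞 K` with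
`𝓞 K ⧸ 𝔑 ≃+* ℤ/Nℤ`: choose one prime `𝔮_q` above each `q ∣ N` and put `𝔑 = ∏ 𝔮_q^{v_q(N)}`;
`𝓞 K ⧸ 𝔮_q^{k} ≅ ℤ/q^k` for split `q` (`e = f = 1`), `𝓞 K ⧸ 𝔮_q ≅ ℤ/q` for ramified `q`
(`f = 1`, exponent `v_q(N) = 1`), and the Chinese remainder theorem. This is the direction "⟸" of
"The existence of such `𝔑` … amounts to the requirement that every prime `q ∣ N` is either split
or ramified in `K`, with `q² ∤ N` in the latter case" ([Cas20] §2.5, author PDF p. 8; §1, p. 2),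
extending the tree's all-split `exists_ideal_quotient_ringEquiv_zmod` (Gross 1991 §1).
-- TODO(general form): the converse direction "⟹" of the printed equivalence is not formalised.
[cite: Castella2020JIMJ, §2.5 (author PDF p. 8), hypothesis (heeg) and the sentence following it]
[cite: Gross1984, §3] -/
theorem exists_ideal_quotient_ringEquiv_zmod_of_split_or_ramified (h2 : finrank ℚ K = 2) {N : ℕ}
    (hN : N ≠ 0)
    (hH : ∀ q : ℕ, q.Prime → q ∣ N →
      ((span {(q : ℤ)}).primesOver (𝓞 K)).ncard = 2 ∨
        ((q : ℤ) ∣ NumberField.discr K ∧ ¬ q ^ 2 ∣ N)) :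
    ∃ 𝔑 : Ideal (𝓞 K), Nonempty (𝓞 K ⧸ 𝔑 ≃+* ZMod N) := by
  have hpr : ∀ q : N.primeFactors, (q : ℕ).Prime := fun q ↦ Nat.prime_of_mem_primeFactors q.2
  have hdv : ∀ q : N.primeFactors, (q : ℕ) ∣ N := fun q ↦ Nat.dvd_of_mem_primeFactors q.2
  set k : N.primeFactors → ℕ := fun q ↦ N.factorization q with hk
  -- per prime: a prime `𝔮_q ∣ q` with `𝓞 K ⧸ 𝔮_q^{k_q} ≃ ℤ/q^{k_q}`
  have key : ∀ q : N.primeFactors, ∃ P : Ideal (𝓞 K), P.IsPrime ∧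
      P.LiesOver (span {((q : ℕ) : ℤ)}) ∧
      Nonempty (𝓞 K ⧸ P ^ k q ≃+* ZMod ((q : ℕ) ^ k q)) := by
    intro q
    rcases hH q (hpr q) (hdv q) with hs | ⟨hd, hsq⟩
    · -- split: `e = f = 1`
      have hne : ((span {((q : ℕ) : ℤ)}).primesOver (𝓞 K)).Nonempty :=
        Set.nonempty_of_ncard_ne_zero (by rw [hs]; exact two_ne_zero)
      obtain ⟨P, hP⟩ := hne
      haveI := hP.1
      haveI := hP.2
      obtain ⟨he, hf⟩ :=
        Literature.NumberTheory.QuadraticFields.SplitPrime.ramificationIdx_eq_one_of_ncard_primesOver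
          (hpr q) (hs.trans h2.symm) hP
      exact ⟨P, hP.1, hP.2,
        Literature.NumberTheory.QuadraticFields.SplitPrime.nonempty_ringEquiv_zmod_pow (hpr q) P he
          hf (k q)⟩
    · -- ramified with exponent one: `f = 1`, `𝓞 K ⧸ 𝔮 ≃ ℤ/q`
      have hk1 : k q = 1 := by
        have h1 : 1 ≤ N.factorization q :=
          ((hpr q).pow_dvd_iff_le_factorization hN).mp (by rw [pow_one]; exact hdv q)
        have h2' : ¬ 2 ≤ N.factorization q := fun h ↦
          hsq (((hpr q).pow_dvd_iff_le_factorization hN).mpr h)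
        simp only [hk]
        omega
      obtain ⟨P, hP, hPo, e⟩ := nonempty_quotient_ringEquiv_zmod_of_dvd_discr h2 (hpr q) hd
      refine ⟨P, hP, hPo, ?_⟩
      rw [hk1, pow_one, pow_one]
      exact e
  choose 𝔭 hP hL e using key
  haveI : ∀ q : N.primeFactors, (𝔭 q).IsPrime := hP
  haveI : ∀ q : N.primeFactors, (𝔭 q).LiesOver (span {((q : ℕ) : ℤ)}) := hL
  have hcop : Pairwise (Function.onFun IsCoprime fun q : N.primeFactors ↦ 𝔭 q ^ k q) := by
    intro q r hqr
    have hp0 : ∀ s : N.primeFactors, (span {((s : ℕ) : ℤ)} : Ideal ℤ) ≠ ⊥ := fun s ↦ by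
      simpa using (Int.natCast_ne_zero.mpr (hpr s).ne_zero)
    have hmax : ∀ s : N.primeFactors, (𝔭 s).IsMaximal := fun s ↦
      (hP s).isMaximal (ne_bot_of_liesOver_of_ne_bot (hp0 s) (𝔭 s))
    have hne : 𝔭 q ≠ 𝔭 r :=
      Literature.NumberTheory.QuadraticFields.SplitPrime.ne_of_liesOver_of_ne (hpr q) (hpr r)
        (fun h ↦ hqr (Subtype.ext h)) (𝔭 q) (𝔭 r)
    haveI := hmax q
    haveI := hmax r
    exact (Ideal.isCoprime_of_isMaximal hne).pow
  refine ⟨⨅ q, 𝔭 q ^ k q, ⟨(Ideal.quotientInfRingEquivPiQuotient _ hcop).trans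
    ((RingEquiv.piCongrRight fun q ↦ (e q).some).trans (ZMod.equivPi N hN).symm)⟩⟩

end Summit.BirchSwinnertonDyer.Rank1Residual.X11b.HeegnerIdeal

end
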